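import Literature.Geometry.Riemannian.HalfSegmentInequality
import HarnessLib

/-!
# Reversal of minimizing geodesic segments; the tangent cut locus is Lebesgue-null

Two further elementary tools for integrating along minimal segments between pairs of points
(the symmetrisation step `x ↔ y` in the proof of the segment inequality, Cheeger–Colding 1996,
Thm. 2.11, on the route to Colding's `L²`-Toponogov theorem and `Colding1996_volume_ghClose`):

* `maximalGeodesic_reverse` — **reversal of maximal geodesics** of a complete connection:
  `γ_{γ_v(b), -γ_v'(b)}(t) = γ_v(b - t)` (uniqueness of geodesics, O'Neill 1983, Ch. 3, Lemma 26
  and Prop. 28; Lee 2018, Cor. 4.28);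
* `IsMinimizingUpTo.reverse` and `exists_isMinimizingUpTo_reverse` — **the reverse of a
  minimizing segment is a minimizing segment**: if `γ_v|[0,1]` minimizes from `p` to
  `q = exp_p v`, then `γ_w|[0,1]`, `w = -γ_v'(1) ∈ T_qM`, minimizes from `q` to `p` and
  `exp_q(s w) = exp_p((1 - s) v)` (Lee 2018, Prop. 6.10 ff.: length and distance are symmetric);
* `volume_setOf_isMinimizingUpTo_diff_injectivityDomain_eq_zero` and
  `volume_preimage_tangentCutLocus_eq_zero` — **in a tangent space framed isometrically by `ℝᵐ`,
  the minimizing directions outside the injectivity domain, in particular the tangent cut locus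
  `TCL(p)`, form a Lebesgue-null set** (each ray meets them in at most its cut time; polar
  coordinates `setLIntegral_eq_lintegral_sphere_radial`; Lee 2018, Thm. 10.34 (a) via Thm. 10.33
  in the book, here directly).

* `ae_eq_setOf_isMinimizingUpTo_setOf_mem_injectivityDomain` and
  `lintegral_jacobian_mul_lintegral_halfSegment_le_of_isMinimizingUpTo` — consequently the
  half segment inequality (`HalfSegmentInequality.lean`) holds with the (closed) set of
  minimizing directions of norm `≤ R` in place of the injectivity domain.

No definitions, no named facts (D-0026).

## References

* B. O'Neill, *Semi-Riemannian Geometry*, Academic Press 1983, Ch. 3, Lemma 26, Prop. 28.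
  [ONeill1983]
* J. M. Lee, *Introduction to Riemannian Manifolds*, 2nd ed., Springer GTM 176 (2018), Cor. 4.28,
  Prop. 5.19, Thm. 10.34 (a). [LeeRiemannianManifolds2018]
* J. Cheeger, T. H. Colding, Ann. of Math. (2) 144 (1996), Thm. 2.11 (proof). [CheegerColding1996]
-/

noncomputable section

open Bundle Set Function Filter MeasureTheory Manifold
open scoped Manifold ContDiff Topology ENNReal NNReal

namespace Literature.Geometry.Riemannian

open Lorentzian Lorentzian.PseudoRiemannianMetric

/-! ### §1. Reversal of maximal geodesics and of minimizing segments -/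

section Reversal

variable {E : Type*} [NormedAddCommGroup E] [NormedSpace ℝ E] {H : Type*} [TopologicalSpace H]
  {I : ModelWithCorners ℝ E H} {M : Type*} [TopologicalSpace M] [ChartedSpace H M]
  [IsManifold I ∞ M] [FiniteDimensional ℝ E] [CompleteSpace E] [T2Space M] [BoundarylessManifold I M]

/-- **Reversal of maximal geodesics** (O'Neill 1983, Ch. 3, Lemma 26 with `h(t) = b - t`, and
uniqueness, Prop. 28; Lee 2018, Cor. 4.28): for a geodesically complete `C¹` connection, the
maximal geodesic issuing from `γ_v(b)` with velocity `-γ_v'(b)` is `t ↦ γ_v(b - t)`.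
[cite: ONeill1983, Ch. 3, Lemma 26 and Prop. 28] -/
theorem maximalGeodesic_reverse {cov : CovariantDerivative I E (TangentSpace I : M → Type _)}
    [CovariantDerivative.ContMDiffCovariantDerivative cov 1] (hc : IsGeodesicallyComplete cov)
    (x : M) (v : TangentSpace I x) (b t : ℝ) :
    maximalGeodesic cov (maximalGeodesic cov x v b) (-(velocity I (maximalGeodesic cov x v) b)) t =
      maximalGeodesic cov x v (b - t) := by
  obtain ⟨-, hgeo, -, -⟩ := maximalGeodesic_of_isGeodesicallyComplete hc x v
  set γ := maximalGeodesic cov x v with hγ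
  -- the reversed curve `t ↦ γ (b - t)`, written `γ (-1 * t + b)` for `comp_affine`
  have h1 : IsGeodesic cov (fun t ↦ γ (-1 * t + b)) := by
    have h := IsGeodesicOn.comp_affine_holds (cov := cov) hgeo (-1) b
    rwa [preimage_univ] at h
  have hx' : (fun t ↦ γ (-1 * t + b)) 0 = γ b := by
    show γ (-1 * 0 + b) = γ b
    rw [mul_zero, zero_add]
  have hv' : velocity I (fun t ↦ γ (-1 * t + b)) 0 = -(velocity I γ b) := by
    rw [velocity_comp_affine γ (-1) b 0, show (-1 : ℝ) * 0 + b = b by ring, neg_one_smul]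
  obtain ⟨-, heq⟩ := maximalGeodesic_unique (cov := cov)
    (IsGeodesic.isMaximalGeodesicOn_univ (cov := cov) h1) (mem_univ _) hx' hv'
  have h2 : maximalGeodesic cov (γ b) (-(velocity I γ b)) t = γ (-1 * t + b) :=
    (heq (mem_univ t)).symm
  rw [h2]
  congr 1
  ring

variable {g : PseudoRiemannianMetric I ∞ E (TangentSpace I : M → Type _)} [g.HasLeviCivita]
  [CovariantDerivative.ContMDiffCovariantDerivative g.leviCivita 1]

/-- **The reverse of a minimizing segment is minimizing** (Lee 2018, Ch. 6: length and
Riemannian distance are symmetric under reversal of curves). For a smooth Riemannian metric with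
complete Levi-Civita connection, if `γ_v|[0,1]` is minimizing from `p`, then the reversed segment,
the geodesic from `q = γ_v(1)` with initial velocity `w = -γ_v'(1)`, is minimizing on `[0, 1]`:
its length `|w|_g = |v|_g` (constant speed) equals `d(q, p) = d(p, q)`.
[cite: LeeRiemannianManifolds2018, Prop. 6.10 and Cor. 5.6] -/
theorem IsMinimizingUpTo.reverse (hg : g.IsRiemannian) (hc : IsGeodesicallyComplete g.leviCivita)
    {p : M} {v : TangentSpace I p} (hmin : IsMinimizingUpTo g hg p v 1) :
    IsMinimizingUpTo g hg (maximalGeodesic g.leviCivita p v 1)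
      (-(velocity I (maximalGeodesic g.leviCivita p v) 1)) 1 := by
  haveI : Fact (1 ≤ (∞ : ℕ∞ω)) := ⟨by exact_mod_cast le_top⟩
  obtain ⟨-, hgeo, h0, hv0⟩ := maximalGeodesic_of_isGeodesicallyComplete hc p v
  set γ := maximalGeodesic g.leviCivita p v with hγ
  set q : M := γ 1 with hq
  set w : TangentSpace I q := -(velocity I γ 1) with hw
  obtain ⟨hdom, -, -, -⟩ := maximalGeodesic_of_isGeodesicallyComplete hc q w
  refine ⟨by rw [hdom]; exact subset_univ _, ?_⟩
  -- the end point of the reversed segment is `p`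
  have hend : maximalGeodesic g.leviCivita q w 1 = p := by
    rw [hw, hq, maximalGeodesic_reverse hc p v 1 1, sub_self]
    exact h0
  -- `g_q(w, w) = g_p(v, v)` (constant speed, `g(-u, -u) = g(u, u)`)
  have haux : ∀ (y : M), y = p → ∀ (u : E), u = (v : E) →
      g.val y (show TangentSpace I y from u) (show TangentSpace I y from u) = g.val p v v := by
    rintro y rfl u rfl
    rfl
  have hspeed : g.val q w w = g.val p v v := by
    have h1 : g.val q w w = g.val (γ 1) (velocity I γ 1) (velocity I γ 1) := by
      have hw' : w = (-1 : ℝ) • velocity I γ 1 := by rw [hw, neg_one_smul]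
      rw [hw']
      simp only [map_smul, FunLike.coe_smul, Pi.smul_apply, smul_eq_mul]
      ring
    rw [h1, hgeo.val_velocity_eq g 1 0]
    exact haux (γ 0) h0 (velocity I γ 0) hv0
  -- lengths and distances
  rw [hend, length_maximalGeodesic hg hc q w 0 1, sub_zero, one_mul, hspeed,
    PseudoRiemannianMetric.edist_comm hg q p]
  have h2 := hmin.2
  rw [length_maximalGeodesic hg hc p v 0 1, sub_zero, one_mul] at h2
  exact h2

/-- **Reversal of a minimizing segment through the exponential map** (existence form, at the base
point `exp_p v`): if `γ_v|[0,1]` is minimizing then there is `w ∈ T_{exp_p v}M` with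
`γ_w|[0,1]` minimizing and `exp_{exp_p v}(s w) = exp_p((1 - s) v)` for all `s` — the same segment
run backwards. [cite: LeeRiemannianManifolds2018, Prop. 6.10 and Prop. 5.19 (b)] -/
theorem exists_isMinimizingUpTo_reverse (hg : g.IsRiemannian)
    (hc : IsGeodesicallyComplete g.leviCivita) {p : M} {v : TangentSpace I p}
    (hmin : IsMinimizingUpTo g hg p v 1) :
    ∃ w : TangentSpace I (riemannianExpMap g p v),
      IsMinimizingUpTo g hg (riemannianExpMap g p v) w 1 ∧
        ∀ s : ℝ, riemannianExpMap g (riemannianExpMap g p v) (s • w) =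
          riemannianExpMap g p ((1 - s) • v) := by
  have hq : riemannianExpMap g p v = maximalGeodesic g.leviCivita p v 1 :=
    expMap_eq_maximalGeodesic hc p v
  rw [hq]
  refine ⟨-(velocity I (maximalGeodesic g.leviCivita p v) 1), hmin.reverse hg hc, fun s ↦ ?_⟩
  show expMap g.leviCivita (maximalGeodesic g.leviCivita p v 1)
      (s • -(velocity I (maximalGeodesic g.leviCivita p v) 1)) = expMap g.leviCivita p ((1 - s) • v)
  rw [expMap_smul hc, expMap_smul hc, maximalGeodesic_reverse hc p v 1 s]

end Reversal

/-! ### §2. Minimizing directions outside the injectivity domain are Lebesgue-null -/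

section NullTangentCutLocus

variable {m : ℕ} {M : Type*} [TopologicalSpace M] [T2Space M]
  [ChartedSpace (EuclideanSpace ℝ (Fin m)) M] [IsManifold (𝓡 m) ∞ M]
  (g : PseudoRiemannianMetric (𝓡 m) ∞ (EuclideanSpace ℝ (Fin m)) (TangentSpace (𝓡 m) : M → Type _))
  [g.HasLeviCivita]

/-- **The minimizing directions outside the injectivity domain are Lebesgue-null.** For a smooth
Riemannian metric on a manifold modelled on `ℝᵐ`, `m ≥ 1`, with compact closed distance balls,
`p ∈ M` and a linear isometry `T : ℝᵐ ≃ (T_pM, g_p)`: the set of `v` with `γ_{Tv}|[0,1]`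
minimizing but `T v ∉ ID(p)` has Lebesgue measure zero — each ray `t ↦ t ξ` meets it at most in
the cut time of `T ξ`, and Lebesgue measure disintegrates in polar coordinates
(`setLIntegral_eq_lintegral_sphere_radial`). Hence integrals over "minimizing directions" and over
the preimage of the injectivity domain agree. [cite: LeeRiemannianManifolds2018, Thm. 10.34 (a)] -/
theorem volume_setOf_isMinimizingUpTo_diff_injectivityDomain_eq_zero (hg : g.IsRiemannian)
    (hm : 1 ≤ m) (hcpl : ∀ (x : M) (r : ℝ≥0), IsCompact {y : M | g.edist hg x y ≤ r}) (p : M)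
    (T : EuclideanSpace ℝ (Fin m) ≃L[ℝ] EuclideanSpace ℝ (Fin m)) :
    volume {v : EuclideanSpace ℝ (Fin m) |
      IsMinimizingUpTo g hg p (T v : TangentSpace (𝓡 m) p) 1 ∧
        (T v : TangentSpace (𝓡 m) p) ∉ injectivityDomain g hg p} = 0 := by
  obtain ⟨k, rfl⟩ : ∃ k, m = k + 1 := ⟨m - 1, by omega⟩
  have hk1' : ((1 : ℕ∞) : ℕ∞ω) + 1 ≤ (∞ : ℕ∞ω) := by
    rw [show ((1 : ℕ∞) : ℕ∞ω) + 1 = 2 by norm_num]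
    exact WithTop.coe_le_coe.2 le_top
  haveI : CovariantDerivative.ContMDiffCovariantDerivative g.leviCivita 1 :=
    ⟨g.isLocallyContMDiff_leviCivita_holds 1 hk1' univ isOpen_univ⟩
  haveI : Fact (1 ≤ (∞ : ℕ∞ω)) := ⟨by exact_mod_cast le_top⟩
  have hc : IsGeodesicallyComplete g.leviCivita :=
    isGeodesicallyComplete_of_isCompact_closedBall hg hcpl
  have hmin_congr : ∀ (w w' : EuclideanSpace ℝ (Fin (k + 1))) (b : ℝ), w = w' →
      (IsMinimizingUpTo g hg p w b ↔ IsMinimizingUpTo g hg p w' b) := by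
    intro w w' b h
    subst h
    exact Iff.rfl
  have hTsmul : ∀ (c : ℝ), 0 < c → ∀ (v : EuclideanSpace ℝ (Fin (k + 1))) (b : ℝ),
      (IsMinimizingUpTo g hg p (T (c • v)) b ↔ IsMinimizingUpTo g hg p (T v) (c * b)) := by
    intro c hc0 v b
    exact (hmin_congr _ _ b (map_smul T c v)).trans
      (isMinimizingUpTo_smul_iff hg hc p (T v) hc0 b)
  -- the minimizing directions `U` and the injectivity domain `L` through the rationals
  set U : Set (EuclideanSpace ℝ (Fin (k + 1))) := {v | IsMinimizingUpTo g hg p (T v) 1} with hU_def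
  have hUm : MeasurableSet U :=
    ((isClosed_setOf_isMinimizingUpTo g le_rfl hg hc p).preimage
      ((T : EuclideanSpace ℝ (Fin (k + 1)) →L[ℝ] EuclideanSpace ℝ (Fin (k + 1))).continuous.prodMk
        continuous_const :
        Continuous fun v : EuclideanSpace ℝ (Fin (k + 1)) ↦ (T v, (1 : ℝ)))).measurableSet
  set L : Set (EuclideanSpace ℝ (Fin (k + 1))) :=
    {v | ∃ q : ℚ, (1 : ℝ) < q ∧ IsMinimizingUpTo g hg p (T v) q} with hL_def
  have hLm : MeasurableSet L := by
    have hq_closed : ∀ q : ℚ, IsClosed {v : EuclideanSpace ℝ (Fin (k + 1)) |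
        IsMinimizingUpTo g hg p (T v) q} := fun q ↦
      (isClosed_setOf_isMinimizingUpTo g le_rfl hg hc p).preimage
        ((T : EuclideanSpace ℝ (Fin (k + 1)) →L[ℝ] EuclideanSpace ℝ (Fin (k + 1))).continuous.prodMk
          continuous_const :
          Continuous fun v : EuclideanSpace ℝ (Fin (k + 1)) ↦ (T v, ((q : ℚ) : ℝ)))
    have heq : L = ⋃ q : ℚ, ({v : EuclideanSpace ℝ (Fin (k + 1)) | (1 : ℝ) < q} ∩
        {v : EuclideanSpace ℝ (Fin (k + 1)) | IsMinimizingUpTo g hg p (T v) q}) := by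
      ext v
      simp only [hL_def, mem_setOf_eq, mem_iUnion, mem_inter_iff]
    rw [heq]
    exact MeasurableSet.iUnion fun q ↦ (MeasurableSet.const _).inter (hq_closed q).measurableSet
  have hLID : ∀ v, v ∈ L ↔ (T v : TangentSpace (𝓡 (k + 1)) p) ∈ injectivityDomain g hg p := by
    intro v
    constructor
    · rintro ⟨q, hq1, hq⟩
      exact ⟨q, hq1, hq⟩
    · rintro ⟨s, hs1, hs⟩
      obtain ⟨q, hq1, hqs⟩ := exists_rat_btwn hs1
      exact ⟨q, hq1, hs.mono hc (zero_le_one.trans hq1.le) hqs.le⟩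
  have hsub : {v : EuclideanSpace ℝ (Fin (k + 1)) |
      IsMinimizingUpTo g hg p (T v : TangentSpace (𝓡 (k + 1)) p) 1 ∧
        (T v : TangentSpace (𝓡 (k + 1)) p) ∉ injectivityDomain g hg p} ⊆ U \ L := by
    rintro v ⟨hvU, hvI⟩
    exact ⟨hvU, fun hvL ↦ hvI ((hLID v).1 hvL)⟩
  refine measure_mono_null hsub ?_
  -- `volume (U \ L) = 0` in polar coordinates: one point per ray
  rw [← setLIntegral_one, setLIntegral_eq_lintegral_sphere_radial k measurable_const (hUm.diff hLm)]
  have hzero : ∀ ξ : Metric.sphere (0 : EuclideanSpace ℝ (Fin (k + 1))) 1,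
      ∫⁻ t in Ioi (0 : ℝ), ENNReal.ofReal (t ^ k) *
        (U \ L).indicator (fun _ ↦ (1 : ℝ≥0∞)) (t • (ξ : EuclideanSpace ℝ (Fin (k + 1)))) = 0 := by
    intro ξ
    set D : Set ℝ := {t | 0 < t ∧ IsMinimizingUpTo g hg p (T ξ) t ∧
      ∀ s : ℝ, t < s → ¬ IsMinimizingUpTo g hg p (T ξ) s} with hD_def
    have hDsub : D.Subsingleton := by
      intro t₁ ht₁ t₂ ht₂
      by_contra hne
      rcases lt_or_gt_of_ne hne with h | h
      · exact ht₁.2.2 t₂ h ht₂.2.1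
      · exact ht₂.2.2 t₁ h ht₁.2.1
    have hD0 : ∀ᵐ t ∂((volume : Measure ℝ).restrict (Ioi 0)), t ∉ D :=
      ae_restrict_of_ae (measure_eq_zero_iff_ae_notMem.1 (hDsub.measure_zero volume))
    rw [← lintegral_zero]
    refine lintegral_congr_ae ?_
    filter_upwards [ae_restrict_mem measurableSet_Ioi, hD0] with t ht htD
    have ht0 : 0 < t := ht
    have hmemU : t • (ξ : EuclideanSpace ℝ (Fin (k + 1))) ∈ U ↔
        IsMinimizingUpTo g hg p (T ξ) t := by
      simp only [hU_def, mem_setOf_eq, hTsmul t ht0, mul_one]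
    have hmemL : t • (ξ : EuclideanSpace ℝ (Fin (k + 1))) ∈ L ↔
        ∃ q : ℚ, (1 : ℝ) < q ∧ IsMinimizingUpTo g hg p (T ξ) (t * q) := by
      simp only [hL_def, mem_setOf_eq, hTsmul t ht0]
    have hnot : t • (ξ : EuclideanSpace ℝ (Fin (k + 1))) ∉ U \ L := by
      rintro ⟨hU, hL⟩
      refine htD ⟨ht0, hmemU.1 hU, fun s hts hs ↦ hL (hmemL.2 ?_)⟩
      obtain ⟨q, hq1, hqs⟩ := exists_rat_btwn ((one_lt_div ht0).2 hts)
      exact ⟨q, hq1, hs.mono hc (mul_nonneg ht0.le (zero_le_one.trans hq1.le))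
        ((lt_div_iff₀' ht0).1 hqs).le⟩
    rw [Set.indicator_of_notMem hnot, mul_zero]
  simp_rw [hzero]
  exact lintegral_zero

/-- **The tangent cut locus is Lebesgue-null** (Lee 2018, Thm. 10.34 (a) through Thm. 10.33 —
`TCL(p)` is the graph of the continuous cut time over the unit sphere; here directly, one point
per ray): for a linear isometry `T : ℝᵐ ≃ (T_pM, g_p)` (indeed any linear equivalence) on a
manifold modelled on `ℝᵐ`, `m ≥ 1`, with compact closed distance balls,
`volume (T⁻¹ TCL(p)) = 0`. [cite: LeeRiemannianManifolds2018, Thm. 10.34 (a)] -/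
theorem volume_preimage_tangentCutLocus_eq_zero (hg : g.IsRiemannian) (hm : 1 ≤ m)
    (hcpl : ∀ (x : M) (r : ℝ≥0), IsCompact {y : M | g.edist hg x y ≤ r}) (p : M)
    (T : EuclideanSpace ℝ (Fin m) ≃L[ℝ] EuclideanSpace ℝ (Fin m)) :
    volume {v : EuclideanSpace ℝ (Fin m) |
      (T v : TangentSpace (𝓡 m) p) ∈ tangentCutLocus g hg p} = 0 := by
  refine measure_mono_null (fun v hv ↦ ?_)
    (volume_setOf_isMinimizingUpTo_diff_injectivityDomain_eq_zero g hg hm hcpl p T)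
  obtain ⟨-, h1, h2⟩ := hv
  exact ⟨h1, fun ⟨s, hs1, hs⟩ ↦ h2 s hs1 hs⟩

/-! ### §3. The half segment inequality over the closed set of minimizing directions -/

/-- The minimizing directions of norm `≤ R` and the injectivity-domain directions of norm `≤ R`
agree up to a Lebesgue-null set (`volume_setOf_isMinimizingUpTo_diff_injectivityDomain_eq_zero`;
conversely `ID(p)` consists of minimizing directions). [cite: LeeRiemannianManifolds2018, Thm. 10.34 (a)] -/
theorem ae_eq_setOf_isMinimizingUpTo_setOf_mem_injectivityDomain (hg : g.IsRiemannian)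
    (hm : 1 ≤ m) (hcpl : ∀ (x : M) (r : ℝ≥0), IsCompact {y : M | g.edist hg x y ≤ r}) (p : M)
    (T : EuclideanSpace ℝ (Fin m) ≃L[ℝ] EuclideanSpace ℝ (Fin m)) (R : ℝ) :
    {v : EuclideanSpace ℝ (Fin m) |
        IsMinimizingUpTo g hg p (T v : TangentSpace (𝓡 m) p) 1 ∧ ‖v‖ ≤ R} =ᵐ[volume]
      {v : EuclideanSpace ℝ (Fin m) |
        (T v : TangentSpace (𝓡 m) p) ∈ injectivityDomain g hg p ∧ ‖v‖ ≤ R} := by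
  have hk1' : ((1 : ℕ∞) : ℕ∞ω) + 1 ≤ (∞ : ℕ∞ω) := by
    rw [show ((1 : ℕ∞) : ℕ∞ω) + 1 = 2 by norm_num]
    exact WithTop.coe_le_coe.2 le_top
  haveI : CovariantDerivative.ContMDiffCovariantDerivative g.leviCivita 1 :=
    ⟨g.isLocallyContMDiff_leviCivita_holds 1 hk1' univ isOpen_univ⟩
  have hc : IsGeodesicallyComplete g.leviCivita :=
    isGeodesicallyComplete_of_isCompact_closedBall hg hcpl
  refine ae_eq_set.2 ⟨?_, ?_⟩
  · refine measure_mono_null (fun v hv ↦ ?_)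
      (volume_setOf_isMinimizingUpTo_diff_injectivityDomain_eq_zero g hg hm hcpl p T)
    exact ⟨hv.1.1, fun h ↦ hv.2 ⟨h, hv.1.2⟩⟩
  · have hempty : {v : EuclideanSpace ℝ (Fin m) |
        (T v : TangentSpace (𝓡 m) p) ∈ injectivityDomain g hg p ∧ ‖v‖ ≤ R} \
        {v : EuclideanSpace ℝ (Fin m) |
          IsMinimizingUpTo g hg p (T v : TangentSpace (𝓡 m) p) 1 ∧ ‖v‖ ≤ R} = ∅ := by
      refine Set.eq_empty_of_forall_notMem fun v hv ↦ hv.2 ?_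
      obtain ⟨⟨s, hs1, hs⟩, hvR⟩ := hv.1
      exact ⟨hs.mono hc zero_le_one hs1.le, hvR⟩
    rw [hempty, measure_empty]

/-- **The half segment inequality over minimizing directions** (Cheeger–Colding 1996, Thm. 2.11,
base-point half): `lintegral_jacobian_mul_lintegral_halfSegment_le_setLIntegral_closedBall` with
the closed set `{v : γ_{Tv}|[0,1] minimizing, ‖v‖ ≤ R}` in place of the injectivity-domain
directions (the two differ by a null set). [cite: CheegerColding1996, Thm. 2.11 (proof)] -/
theorem lintegral_jacobian_mul_lintegral_halfSegment_le_of_isMinimizingUpTo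
    [SecondCountableTopology M] [T3Space M] [MeasurableSpace M] [BorelSpace M] [ConnectedSpace M]
    (hg : g.IsRiemannian) (hm : 2 ≤ m)
    (hcpl : ∀ (x : M) (r : ℝ≥0), IsCompact {y : M | g.edist hg x y ≤ r})
    (hRic : ∀ (x : M) (w : TangentSpace (𝓡 m) x), ((m : ℝ) - 1) * g.val x w w ≤ g.ricci x w w)
    (p : M) (T : EuclideanSpace ℝ (Fin m) ≃L[ℝ] EuclideanSpace ℝ (Fin m))
    (hT : ∀ v, g.val p (T v) (T v) = ‖v‖ ^ 2) {e : M → ℝ≥0∞} (he : Measurable e)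
    {R : ℝ} (hR0 : 0 ≤ R) (hRπ : R ≤ Real.pi / 2) :
    ∫⁻ v in {v : EuclideanSpace ℝ (Fin m) |
        IsMinimizingUpTo g hg p (T v : TangentSpace (𝓡 m) p) 1 ∧ ‖v‖ ≤ R},
      ENNReal.ofReal (Real.sqrt (Matrix.det (Matrix.of fun i j : Fin m ↦
          g.val (riemannianExpMap g p (T v))
            (mfderiv 𝓘(ℝ, EuclideanSpace ℝ (Fin m)) (𝓡 m)
              (fun v : EuclideanSpace ℝ (Fin m) ↦ riemannianExpMap g p (T v)) v
              (EuclideanSpace.single i (1 : ℝ)))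
            (mfderiv 𝓘(ℝ, EuclideanSpace ℝ (Fin m)) (𝓡 m)
              (fun v : EuclideanSpace ℝ (Fin m) ↦ riemannianExpMap g p (T v)) v
              (EuclideanSpace.single j (1 : ℝ)))))) *
        ∫⁻ s in Icc (1 / 2 : ℝ) 1, e (riemannianExpMap g p (T (s • v))) ≤
      2 ^ (m - 1) * ∫⁻ y in {y : M | g.edist hg p y ≤ ENNReal.ofReal R}, e y ∂g.riemVolume := by
  rw [setLIntegral_congr
    (ae_eq_setOf_isMinimizingUpTo_setOf_mem_injectivityDomain g hg (by omega) hcpl p T R)]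
  exact lintegral_jacobian_mul_lintegral_halfSegment_le_setLIntegral_closedBall g hg hm hcpl hRic
    p T hT he hR0 hRπ

end NullTangentCutLocus

end Literature.Geometry.Riemannian

end
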